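import Summits.Parity.BatemanHorn.Theses.HurwitzTauber

/-!
# Birth skeleton — crux `LogMobiusTail` (route `HurwitzTauber`, item `stmt-Parity-19022`)

Line `birth` (skeleton registrar, BC3).  Notation of the route file: a Bateman–Horn system
`f = (f₁,…,f_k)`, divisor tuples `d = (dᵢ)` with `dᵢ ∣ fᵢ(n)` (values as `toNat`, so `fᵢ(n) ≤ 0`
contributes nothing), `L = lcm(d)`, weight `w(d) = ∏ᵢ μ(dᵢ) log dᵢ`, Abel weight `n^{-σ}`, `σ → 1⁺`.
The crux is the LOG/ABEL-AVERAGED MÖBIUS TAIL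

  `T(σ,n) := n^{-σ} Σ_{d ∣ f(n), L ≥ n} w(d)`,  `Σ_n T(σ,n)` summable (`σ > 1`) and `(σ−1) Σ_n T(σ,n) → 0`.

In the Hurwitz frame the cut `L ≥ n` is the LEVEL-ONE seam: for `L < n` the `n`-sum over a root class
`mod L` runs over complete periods (polar part + singular series + Hurwitz remainder, the other items of
the route); for `L ≥ n` it is incomplete (fewer than one period).  This line cuts the incomplete range once
more, at LEVEL TWO (`L = n²`), exactly as foreseen in the route header ("LogMobiusTail ⇐ NearStub
(n ≤ lcm ≤ n²) → DeepStub (lcm > n²)"):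

* NEAR CELL `n ≤ L ≤ n²` — moduli between the length and its square (stub `stub_nearCell`): raising the
  level of distribution of the `μ·log`-weighted divisor problem along `f` from `1` to `2` in the Abel mean.
  For one quadratic `f` these are the divisors `d = f(n)/e`, `2 ≤ e ≤ n`, read through a SMALL cofactor;
  for the twin system `(X, X+2)` they contain `d = (n, d₂)`, `d₂ ∣ n+2` proper.
* DEEP CELL `L > n²` — moduli beyond the square of the length (stub `stub_deepCell`).  For systems of
  total degree `G = Σ deg fᵢ ≤ 2` this is the top sliver `L ∈ (n², F(n)]`, `F(n) = ∏ fᵢ(n)`: for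
  `f = X²+1` exactly the one-point term `μ(n²+1) log(n²+1)`, for twins exactly `μ(n)μ(n+2) log n log(n+2)`
  (`n` odd) — the log-weighted polynomial / 2-point CHOWLA term in the Abel mean; for `G ≥ 3` it is the
  bulk `(n², F(n)]` of the tail.

`T = T_near + T_deep` termwise (`sum_filter_tail_split`, `tail_eq_near_add_deep`, proved), and the
two-part conclusion shape is additive (`abelNull_add`, proved: `Summable.add`, `Summable.tsum_add` on
`σ > 1`, `Tendsto.add`; `tail_of_cells`), so `stub_nearCell → stub_deepCell → LogMobiusTail` (`LogMobiusTail_of`, proved,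
concluding the route decl BY NAME; hypothesis form as the `example` after it).

STRENGTH CAVEAT (honest bin): the seam `L = n²` cuts through the divisor telescoping
`Σ_{d ∣ m} μ(d) log d = −Λ(m)`, so each cell on its own is a Chowla-type statement WITH ONE LOGARITHM OF
SAVING (e.g. the deep cell for `X²+1` follows from `Σ_{n ≤ x} μ(n²+1) = o(x / log x)` and its log-mean
form `Σ_{n≤x} μ(n²+1) log(n²+1)/n = o(log x)` has trivial bound `≍ log² x`), whereas the crux (their sum)
is of Bateman–Horn strength (given `RootHurwitzLaw` it is BH in the Abel mean).  Möbius randomness along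
`f` predicts square-root cancellation in both cells, so both are standard predictions; the conjunction is
formally STRONGER than the crux and NO CONVERSE is claimed (the cells could cancel each other).  The split
is a LOCALISATION of the route's designated parity core (rank 2), not a redirect.

Degenerate members (sanity, as for the crux): `k = 0` — near cell `= [n = 1]`, deep cell `= 0`, both
statements true; `k = 1` linear — the deep cell is eventually empty (true), the near cell is PNT in
progressions; the content starts at one quadratic / a linear pair.

Disproof used: none relevant — `ledger crux ls stmt-Parity-19022`: no workfiles (no `Disproof.lean`, no
`_false_without_` theorem, no `Negative/` lemma) on 2026-08-17; `ledger negatives --problem Parity` lists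
three GHL-side statements (stmt-Parity-9541, 14832, 4218), none about divisor-tuple cells of a fixed
polynomial system.  Dead lines: none recorded for this crux.  Prior birth skeleton: the route opener's
`bc/LogMobiusTail_birth.lean` (evidence 2026-08-17T03:45Z, same Near/Deep cut per the route header) is
not readable from this seat; this file re-creates it independently.
-/

namespace Summit.Parity.BatemanHorn.Cruxes.LogMobiusTail.Birth

open scoped BigOperators
open Filter

/-! ### Registered stubs (the only `sorry`s of the line) -/

/-- stub (NEAR CELL — moduli between the length and its square; level `1 → 2`):
for every Bateman–Horn system `f`, with
`T₁(σ,n) = n^{-σ} Σ_{d : dᵢ ∣ fᵢ(n), n ≤ lcm d ≤ n²} ∏ᵢ μ(dᵢ) log dᵢ`,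
`Σ_n T₁(σ,n)` is summable for `σ > 1` and `(σ−1) Σ_n T₁(σ,n) → 0` as `σ → 1⁺`.
Reading: per tuple `d` of modulus `L = lcm d ∈ [n, n²]` the `n`-sum over the joint root classes of
`f mod L` is incomplete (length `≤ L`, at least `√L`): a `μ·log`-twisted incomplete-sum / level-of-
distribution-two statement in the Abel mean.  Why plausibly true: Möbius randomness of the large
divisors `d` (for one quadratic, `d = f(n)/e` with a small cofactor `e ≤ n`; root classes of `f mod e`
equidistributed, Hooley 1964 / Duke–Friedlander–Iwaniec 1995 / Tóth 2000 for the modulus side) predicts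
square-root cancellation; only one logarithm of saving is needed (trivial bound of the log-mean
`≍ log^{k+1} x` against the required `o(log x)`).  Size: open problem (parity-sensitive: the cell carries
`μ` of divisors exceeding the length).  Summability conjunct: routine (`|T₁(σ,n)| ≤ n^{-σ} ∏ᵢ τ(fᵢ(n))
log fᵢ(n) ≪_ε n^{-σ+ε}`). -/
theorem stub_nearCell :
    ∀ (k : ℕ) (f : Fin k → Polynomial ℤ), Literature.NumberTheory.Sieve.IsBatemanHornSystem f →
    let T₁ : ℝ → ℕ → ℝ := fun σ n => (n : ℝ) ^ (-σ) *
      ∑ d ∈ (Fintype.piFinset (fun i => (((f i).eval (n : ℤ)).toNat).divisors)).filter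
        (fun d => n ≤ Finset.univ.lcm d ∧ Finset.univ.lcm d ≤ n ^ 2),
        ∏ i, ((ArithmeticFunction.moebius (d i) : ℝ) * Real.log (d i));
    (∀ σ : ℝ, 1 < σ → Summable (T₁ σ)) ∧
      Filter.Tendsto (fun σ : ℝ => (σ - 1) * ∑' n : ℕ, T₁ σ n) (nhdsWithin 1 (Set.Ioi 1)) (nhds 0) := by
  sorry

/-- stub (DEEP CELL — moduli beyond the square of the length):
for every Bateman–Horn system `f`, with
`T₂(σ,n) = n^{-σ} Σ_{d : dᵢ ∣ fᵢ(n), n² < lcm d} ∏ᵢ μ(dᵢ) log dᵢ`,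
`Σ_n T₂(σ,n)` is summable for `σ > 1` and `(σ−1) Σ_n T₂(σ,n) → 0` as `σ → 1⁺`.
Reading: for total degree `G = Σ deg fᵢ ≤ 2` the cell is the top sliver `lcm d ∈ (n², ∏ fᵢ(n)]` — for
`f = X²+1` exactly `μ(n²+1) log(n²+1)`, for `(X, X+2)` exactly `μ(n) μ(n+2) log n log(n+2)` (`n` odd):
the log-weighted one-point polynomial / two-point Chowla sum in the Abel mean, with one logarithm of
saving (it follows from `Σ_{n≤x} μ(n²+1) = o(x/log x)`, resp. `Σ_{n≤x} μ(n)μ(n+2) = o(x/log² x)`);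
for `G ≥ 3` it is the bulk `(n², ∏ fᵢ(n)]` of the tail (moduli far beyond the length: fewer than one
root per modulus is met).  Why plausibly true: Möbius randomness along `f` (Chowla / Bateman–Horn
heuristics) predicts square-root cancellation; log-averaged two-point Chowla is a theorem without the
rate (Tao 2016, multiplicativity in `n` used — absent along `n² + 1`).  Size: open problem (the parity
core proper).  Eventually empty, hence true, for `k = 1` linear and for `k = 0`. -/
theorem stub_deepCell :
    ∀ (k : ℕ) (f : Fin k → Polynomial ℤ), Literature.NumberTheory.Sieve.IsBatemanHornSystem f →
    let T₂ : ℝ → ℕ → ℝ := fun σ n => (n : ℝ) ^ (-σ) *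
      ∑ d ∈ (Fintype.piFinset (fun i => (((f i).eval (n : ℤ)).toNat).divisors)).filter
        (fun d => n ^ 2 < Finset.univ.lcm d),
        ∏ i, ((ArithmeticFunction.moebius (d i) : ℝ) * Real.log (d i));
    (∀ σ : ℝ, 1 < σ → Summable (T₂ σ)) ∧
      Filter.Tendsto (fun σ : ℝ => (σ - 1) * ∑' n : ℕ, T₂ σ n) (nhdsWithin 1 (Set.Ioi 1)) (nhds 0) := by
  sorry

/-! ### Glue (all proved): the level-two cut is exact and the conclusion shape is additive -/

noncomputable section

/-- The divisor tuples of `f` at `n`: `d` with `dᵢ ∣ fᵢ(n)` (route convention: `toNat` values). -/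
def divTuples {k : ℕ} (f : Fin k → Polynomial ℤ) (n : ℕ) : Finset (Fin k → ℕ) :=
  Fintype.piFinset (fun i => (((f i).eval (n : ℤ)).toNat).divisors)

/-- The weight `w(d) = ∏ᵢ μ(dᵢ) log dᵢ` of a divisor tuple. -/
def weight {k : ℕ} (d : Fin k → ℕ) : ℝ :=
  ∏ i, ((ArithmeticFunction.moebius (d i) : ℝ) * Real.log (d i))

/-- The crux's tail term `T(σ,n)` (verbatim the `let T` of `HurwitzTauber.LogMobiusTail`). -/
def tailTerm {k : ℕ} (f : Fin k → Polynomial ℤ) (σ : ℝ) (n : ℕ) : ℝ :=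
  (n : ℝ) ^ (-σ) * ∑ d ∈ (divTuples f n).filter (fun d => n ≤ Finset.univ.lcm d), weight d

/-- The near-cell term `T₁(σ,n)` (the `let T₁` of `stub_nearCell`). -/
def nearTerm {k : ℕ} (f : Fin k → Polynomial ℤ) (σ : ℝ) (n : ℕ) : ℝ :=
  (n : ℝ) ^ (-σ) *
    ∑ d ∈ (divTuples f n).filter (fun d => n ≤ Finset.univ.lcm d ∧ Finset.univ.lcm d ≤ n ^ 2), weight d

/-- The deep-cell term `T₂(σ,n)` (the `let T₂` of `stub_deepCell`). -/
def deepTerm {k : ℕ} (f : Fin k → Polynomial ℤ) (σ : ℝ) (n : ℕ) : ℝ :=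
  (n : ℝ) ^ (-σ) * ∑ d ∈ (divTuples f n).filter (fun d => n ^ 2 < Finset.univ.lcm d), weight d

end

/-- **The cut is exact** (generic): inside `n ≤ L`, the brackets `L ≤ n²` / `n² < L` are complementary,
and `n² < L` already forces `n ≤ L`. [folklore] -/
theorem sum_filter_tail_split {ι : Type*} (s : Finset ι) (L : ι → ℕ) (g : ι → ℝ) (n : ℕ)
    [DecidablePred fun d => n ≤ L d] [DecidablePred fun d => n ≤ L d ∧ L d ≤ n ^ 2]
    [DecidablePred fun d => n ^ 2 < L d] :
    ∑ d ∈ s.filter (fun d => n ≤ L d), g d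
      = ∑ d ∈ s.filter (fun d => n ≤ L d ∧ L d ≤ n ^ 2), g d
        + ∑ d ∈ s.filter (fun d => n ^ 2 < L d), g d := by
  simp only [Finset.sum_filter]
  rw [← Finset.sum_add_distrib]
  refine Finset.sum_congr rfl fun d _ => ?_
  by_cases h1 : n ≤ L d
  · by_cases h2 : L d ≤ n ^ 2
    · rw [if_pos h1, if_pos ⟨h1, h2⟩, if_neg (not_lt.mpr h2), add_zero]
    · rw [if_pos h1, if_neg (fun h => h2 h.2), if_pos (not_le.mp h2), zero_add]
  · have h3 : ¬ n ^ 2 < L d := fun h => h1 (le_trans (Nat.le_self_pow two_ne_zero n) h.le)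
    rw [if_neg h1, if_neg (fun h => h1 h.1), if_neg h3, add_zero]

/-- **The cut is exact** (the crux's terms): `T(σ,n) = T₁(σ,n) + T₂(σ,n)` for every system, `σ`, `n`. -/
theorem tail_eq_near_add_deep {k : ℕ} (f : Fin k → Polynomial ℤ) (σ : ℝ) (n : ℕ) :
    tailTerm f σ n = nearTerm f σ n + deepTerm f σ n := by
  unfold tailTerm nearTerm deepTerm
  rw [← mul_add, sum_filter_tail_split]

/-- The two-part conclusion shape (summable for every `σ > 1`, and `(σ−1) Σ_n a σ n → 0` as
`σ → 1⁺`) is additive in the double sequence: on `σ > 1` both series converge, so the `tsum` and the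
limit split (`Summable.add`, `Summable.tsum_add`, `Tendsto.add`, congruence on `nhdsWithin 1 (Ioi 1)`). -/
theorem abelNull_add {a b : ℝ → ℕ → ℝ}
    (ha : (∀ σ : ℝ, 1 < σ → Summable (a σ)) ∧
      Filter.Tendsto (fun σ : ℝ => (σ - 1) * ∑' n : ℕ, a σ n) (nhdsWithin 1 (Set.Ioi 1)) (nhds 0))
    (hb : (∀ σ : ℝ, 1 < σ → Summable (b σ)) ∧
      Filter.Tendsto (fun σ : ℝ => (σ - 1) * ∑' n : ℕ, b σ n) (nhdsWithin 1 (Set.Ioi 1)) (nhds 0)) :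
    (∀ σ : ℝ, 1 < σ → Summable (fun n => a σ n + b σ n)) ∧
      Filter.Tendsto (fun σ : ℝ => (σ - 1) * ∑' n : ℕ, (a σ n + b σ n))
        (nhdsWithin 1 (Set.Ioi 1)) (nhds 0) := by
  refine ⟨fun σ hσ => (ha.1 σ hσ).add (hb.1 σ hσ), ?_⟩
  have hev : (fun σ : ℝ => (σ - 1) * ∑' n : ℕ, a σ n + (σ - 1) * ∑' n : ℕ, b σ n)
      =ᶠ[nhdsWithin 1 (Set.Ioi 1)] (fun σ : ℝ => (σ - 1) * ∑' n : ℕ, (a σ n + b σ n)) := by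
    filter_upwards [self_mem_nhdsWithin] with σ hσ
    rw [(ha.1 σ hσ).tsum_add (hb.1 σ hσ), mul_add]
  have h := (ha.2.add hb.2).congr' hev
  rw [add_zero] at h
  exact h

/-- The crux AT ONE SYSTEM from the two cells at that system (termwise identity + additivity). -/
theorem tail_of_cells {k : ℕ} (f : Fin k → Polynomial ℤ)
    (h1 : (∀ σ : ℝ, 1 < σ → Summable (nearTerm f σ)) ∧
      Filter.Tendsto (fun σ : ℝ => (σ - 1) * ∑' n : ℕ, nearTerm f σ n)
        (nhdsWithin 1 (Set.Ioi 1)) (nhds 0))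
    (h2 : (∀ σ : ℝ, 1 < σ → Summable (deepTerm f σ)) ∧
      Filter.Tendsto (fun σ : ℝ => (σ - 1) * ∑' n : ℕ, deepTerm f σ n)
        (nhdsWithin 1 (Set.Ioi 1)) (nhds 0)) :
    (∀ σ : ℝ, 1 < σ → Summable (tailTerm f σ)) ∧
      Filter.Tendsto (fun σ : ℝ => (σ - 1) * ∑' n : ℕ, tailTerm f σ n)
        (nhdsWithin 1 (Set.Ioi 1)) (nhds 0) := by
  have e : tailTerm f = fun σ n => nearTerm f σ n + deepTerm f σ n :=
    funext fun σ => funext fun n => tail_eq_near_add_deep f σ n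
  rw [e]
  exact abelNull_add h1 h2

/-! ### Composition: the two stubs give the crux BY NAME -/

/-- THE SKELETON THEOREM: the crux `HurwitzTauber.LogMobiusTail`, concluded BY NAME from the two
registered stubs (no `sorry` here; `#print axioms` today = the stubs' `sorryAx` + the standard three). -/
theorem LogMobiusTail_of : Summit.Parity.BatemanHorn.Theses.HurwitzTauber.LogMobiusTail := by
  intro k f hf
  exact tail_of_cells f (stub_nearCell k f hf) (stub_deepCell k f hf)

/-- ASSEMBLY IN HYPOTHESIS FORM (kernel-checked, sorry-free):
`stub_nearCell-sig → stub_deepCell-sig → LogMobiusTail`. -/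
example :
    (∀ (k : ℕ) (f : Fin k → Polynomial ℤ), Literature.NumberTheory.Sieve.IsBatemanHornSystem f →
    let T₁ : ℝ → ℕ → ℝ := fun σ n => (n : ℝ) ^ (-σ) *
      ∑ d ∈ (Fintype.piFinset (fun i => (((f i).eval (n : ℤ)).toNat).divisors)).filter
        (fun d => n ≤ Finset.univ.lcm d ∧ Finset.univ.lcm d ≤ n ^ 2),
        ∏ i, ((ArithmeticFunction.moebius (d i) : ℝ) * Real.log (d i));
    (∀ σ : ℝ, 1 < σ → Summable (T₁ σ)) ∧
      Filter.Tendsto (fun σ : ℝ => (σ - 1) * ∑' n : ℕ, T₁ σ n) (nhdsWithin 1 (Set.Ioi 1)) (nhds 0)) →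
    (∀ (k : ℕ) (f : Fin k → Polynomial ℤ), Literature.NumberTheory.Sieve.IsBatemanHornSystem f →
    let T₂ : ℝ → ℕ → ℝ := fun σ n => (n : ℝ) ^ (-σ) *
      ∑ d ∈ (Fintype.piFinset (fun i => (((f i).eval (n : ℤ)).toNat).divisors)).filter
        (fun d => n ^ 2 < Finset.univ.lcm d),
        ∏ i, ((ArithmeticFunction.moebius (d i) : ℝ) * Real.log (d i));
    (∀ σ : ℝ, 1 < σ → Summable (T₂ σ)) ∧
      Filter.Tendsto (fun σ : ℝ => (σ - 1) * ∑' n : ℕ, T₂ σ n) (nhdsWithin 1 (Set.Ioi 1)) (nhds 0)) →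
    Summit.Parity.BatemanHorn.Theses.HurwitzTauber.LogMobiusTail := by
  intro hnear hdeep k f hf
  exact tail_of_cells f (hnear k f hf) (hdeep k f hf)

end Summit.Parity.BatemanHorn.Cruxes.LogMobiusTail.Birth
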